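import Literature.NumberTheory.LFunctions.HybridCharSumWeil
import Literature.NumberTheory.LFunctions.QuadraticCharacterShiftSumsPrimePow
import HarnessLib

/-!
# Complete twisted character sums of products of linear factors modulo the conductor of a
# primitive quadratic character (Tao–Teräväinen §3.4)

Topic `Literature/NumberTheory/LFunctions`, grouping namespace `PolyCharSum`. T. Tao,
J. Teräväinen, *The Hardy–Littlewood–Chowla conjecture in the presence of a Siegel zero*, J. London
Math. Soc. (2) 106 (2022), arXiv:2109.06291, §3.4: "If `p` is a prime we have the standard Weil
bounds (3.13) `Σ_{n ∈ ℤ/pℤ} χ_p(f(n)) e_p(an) ≪ p^{1/2}` uniformly for all integers `a` whenever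
`f` is not a constant multiple of a perfect square modulo `p` … When `f` is a constant multiple of
a perfect square, we can of course use the trivial bound of `O(p)`. Since the exceptional modulus
`q_χ` is a fundamental discriminant, it is of the form `2^j p_1 ⋯ p_m` for some `j ≤ 3` and
distinct odd primes `p_1, …, p_m`, and so from the Chinese remainder theorem we obtain the bounds
`Σ_{n ∈ ℤ/q_χℤ} χ(f(n)) e_{q_χ}(an) ≪ τ(q_χ)^{O(1)} q_χ^{1/2} d^{1/2}` uniformly in `a`, where `d`
is the largest factor of `q_χ` for which `f` is a constant multiple of a perfect square modulo
`d`." We PROVE this for `f` a product of integer linear factors `Π_{h ∈ H} (A_h X + B_h)` (the case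
of Lemma 3.7), with the following explicit form:

* `polyCharSum n ψ H A B φ = Σ_{z mod n} (Π_{h ∈ H} ψ(A_h z + B_h)) φ(z)` for a Dirichlet
  character `ψ` mod `n` and an additive character `φ` of `ℤ/nℤ`; `polyDisc H A B =
  Π_h A_h · Π_{i ≠ j} (A_i B_j − A_j B_i)` (non-vanishing mod `p` says: `f` has `#H` distinct
  simple roots mod `p`, in particular is not a constant times a square);
* `polyCharSum_mul_of_coprime` — CRT multiplicativity in the modulus (components `crtFst`,
  `crtSnd` of `DirichletCharacterCRT.lean`, and the two pieces of `φ`);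
* `norm_polyCharSum_prime_le` — at an odd prime `p ∤ polyDisc`, `‖·‖ ≤ #H √p` for the quadratic
  character, by the Weil bound `HybridLFunction.norm_hybridSum_add_le` (Stepanov's method, this
  tree); the trivial bound `‖·‖ ≤ n` otherwise (`norm_polyCharSum_le_card`);
* **`norm_polyCharSum_le`** — for a PRIMITIVE QUADRATIC `ψ` mod `q` (so `q = 2^j · squarefree odd`,
  `j ∈ {0, 2, 3}`, `QuadraticCharacterShiftSumsLocal.lean`), `H ≠ ∅` and every `φ`:
  `‖polyCharSum q ψ H A B φ‖ ≤ 2^{3/2} · #H^{ω(q)} · √q · √((q, |polyDisc|))`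
  (induction over the factorisation of `q`). [cite: TaoTeravainen2021, §3.4, (3.13) and the display after it]

## References

* T. Tao, J. Teräväinen, arXiv:2109.06291, §3.4.
* A. Weil, *On some exponential sums*, Proc. Nat. Acad. Sci. USA 34 (1948) 204–207.
* W. M. Schmidt, *Equations over Finite Fields*, LNM 536 (1976), Ch. II Theorem 2G.
-/

noncomputable section

open Finset DirichletCharacter

namespace Literature.NumberTheory.LFunctions

namespace PolyCharSum

/-! ### Definitions and the trivial bound -/

/-- The complete twisted sum `Σ_{z mod n} (Π_{h ∈ H} ψ(A_h z + B_h)) φ(z)`.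
[cite: TaoTeravainen2021, §3.4] -/
def polyCharSum (n : ℕ) [NeZero n] (ψ : DirichletCharacter ℂ n) (H : Finset ℕ) (A B : ℕ → ℤ)
    (φ : AddChar (ZMod n) ℂ) : ℂ :=
  ∑ z : ZMod n, (∏ h ∈ H, ψ ((A h : ZMod n) * z + (B h : ZMod n))) * φ z

/-- The integer `Δ = Π_h A_h · Π_{i ≠ j} (A_i B_j − A_j B_i)`: a prime `p ∤ Δ` sees `#H` distinct
simple roots `−B_h/A_h` of `Π_h (A_h X + B_h)`. [cite: TaoTeravainen2021, §3.4 and proof of Lemma 3.7] -/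
def polyDisc (H : Finset ℕ) (A B : ℕ → ℤ) : ℤ :=
  (∏ h ∈ H, A h) * ∏ i ∈ H, ∏ j ∈ H.erase i, (A i * B j - A j * B i)

variable {n : ℕ} [NeZero n]

/-- The trivial bound `‖polyCharSum‖ ≤ n`. [cite: TaoTeravainen2021, §3.4 ("the trivial bound of `O(p)`")] -/
theorem norm_polyCharSum_le_card (ψ : DirichletCharacter ℂ n) (H : Finset ℕ) (A B : ℕ → ℤ)
    (φ : AddChar (ZMod n) ℂ) : ‖polyCharSum n ψ H A B φ‖ ≤ n := by
  unfold polyCharSum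
  calc ‖∑ z : ZMod n, (∏ h ∈ H, ψ ((A h : ZMod n) * z + (B h : ZMod n))) * φ z‖
      ≤ ∑ z : ZMod n, ‖(∏ h ∈ H, ψ ((A h : ZMod n) * z + (B h : ZMod n))) * φ z‖ :=
        norm_sum_le _ _
    _ ≤ ∑ _z : ZMod n, (1 : ℝ) := by
        refine Finset.sum_le_sum fun z _ => ?_
        rw [norm_mul, AddChar.norm_apply, mul_one]
        rw [norm_prod]
        exact Finset.prod_le_one (fun _ _ => norm_nonneg _) fun h _ => ψ.norm_le_one _
    _ = n := by rw [Finset.sum_const, Finset.card_univ, ZMod.card, nsmul_eq_mul, mul_one]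

/-! ### CRT multiplicativity in the modulus -/

section CRT

variable {a b : ℕ} [NeZero a] [NeZero b]

/-- The first piece of an additive character of `ℤ/abℤ` ((a, b) = 1): `u ↦ φ(e⁻¹(u, 0))`. [folklore] -/
def addCharFst (h : a.Coprime b) (φ : AddChar (ZMod (a * b)) ℂ) : AddChar (ZMod a) ℂ :=
  φ.compAddMonoidHom ((ZMod.chineseRemainder h).symm.toAddMonoidHom.comp (AddMonoidHom.inl _ _))

/-- The second piece of an additive character of `ℤ/abℤ`: `v ↦ φ(e⁻¹(0, v))`. [folklore] -/
def addCharSnd (h : a.Coprime b) (φ : AddChar (ZMod (a * b)) ℂ) : AddChar (ZMod b) ℂ :=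
  φ.compAddMonoidHom ((ZMod.chineseRemainder h).symm.toAddMonoidHom.comp (AddMonoidHom.inr _ _))

omit [NeZero a] [NeZero b] in
/-- `φ(e⁻¹(u, v)) = φ₁(u) φ₂(v)`. [folklore] -/
theorem apply_symm_eq_addCharFst_mul_addCharSnd (h : a.Coprime b) (φ : AddChar (ZMod (a * b)) ℂ)
    (u : ZMod a) (v : ZMod b) :
    φ ((ZMod.chineseRemainder h).symm (u, v)) = addCharFst h φ u * addCharSnd h φ v := by
  have huv : ((u, v) : ZMod a × ZMod b) = (u, 0) + (0, v) := by simp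
  rw [huv, map_add, AddChar.map_add_eq_mul]
  rfl

omit [NeZero a] [NeZero b] in
/-- Integers are diagonal under CRT: `e⁻¹(k, k) = k`. [folklore] -/
theorem symm_intCast (h : a.Coprime b) (k : ℤ) :
    (ZMod.chineseRemainder h).symm ((k : ZMod a), (k : ZMod b)) = (k : ZMod (a * b)) := by
  rw [← PrimitiveQuadratic.chineseRemainder_intCast h k, RingEquiv.symm_apply_apply]

/-- **CRT multiplicativity** ("from the Chinese remainder theorem"): for `(a, b) = 1`,
`Σ_{z mod ab} Π_h ψ(A_h z + B_h) φ(z)` is the product of the corresponding sums for the components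
`ψ_a, φ₁` mod `a` and `ψ_b, φ₂` mod `b`. [cite: TaoTeravainen2021, §3.4] -/
theorem polyCharSum_mul_of_coprime (h : a.Coprime b) (ψ : DirichletCharacter ℂ (a * b))
    (H : Finset ℕ) (A B : ℕ → ℤ) (φ : AddChar (ZMod (a * b)) ℂ) :
    polyCharSum (a * b) ψ H A B φ =
      polyCharSum a (crtFst h ψ) H A B (addCharFst h φ) *
        polyCharSum b (crtSnd h ψ) H A B (addCharSnd h φ) := by
  set e := ZMod.chineseRemainder h with he
  unfold polyCharSum
  have step1 : ∑ z : ZMod (a * b), (∏ k ∈ H, ψ ((A k : ZMod (a * b)) * z + (B k : ZMod (a * b))))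
      * φ z = ∑ p : ZMod a × ZMod b, (∏ k ∈ H, ψ ((A k : ZMod (a * b)) * e.symm p +
        (B k : ZMod (a * b)))) * φ (e.symm p) :=
    (Equiv.sum_comp e.symm.toEquiv (fun z : ZMod (a * b) =>
      (∏ k ∈ H, ψ ((A k : ZMod (a * b)) * z + (B k : ZMod (a * b)))) * φ z)).symm
  rw [step1, Fintype.sum_prod_type, Finset.sum_mul_sum]
  refine Finset.sum_congr rfl fun u _ => Finset.sum_congr rfl fun v _ => ?_
  have harg : ∀ k : ℕ, (A k : ZMod (a * b)) * e.symm (u, v) + (B k : ZMod (a * b)) =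
      e.symm ((A k : ZMod a) * u + (B k : ZMod a), (A k : ZMod b) * v + (B k : ZMod b)) := by
    intro k
    rw [← symm_intCast h (A k), ← symm_intCast h (B k), ← he, ← map_mul, ← map_add,
      Prod.mk_mul_mk, Prod.mk_add_mk]
  have hmul : ∏ k ∈ H, ψ ((A k : ZMod (a * b)) * e.symm (u, v) + (B k : ZMod (a * b))) =
      (∏ k ∈ H, crtFst h ψ ((A k : ZMod a) * u + (B k : ZMod a))) *
        ∏ k ∈ H, crtSnd h ψ ((A k : ZMod b) * v + (B k : ZMod b)) := by
    rw [← Finset.prod_mul_distrib]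
    refine Finset.prod_congr rfl fun k _ => ?_
    rw [harg k, he, apply_symm_eq_crtFst_mul_crtSnd]
  rw [hmul, he, apply_symm_eq_addCharFst_mul_addCharSnd]
  ring

end CRT

/-! ### The prime case: Weil's bound -/

section Prime

variable {p : ℕ} [Fact p.Prime]

/-- Every additive character of `ℤ/nℤ` is `x ↦ e(bx/n)` for some `b` (the `n` characters
`stdAddChar(b ·)` are distinct). [folklore] -/
theorem exists_eq_stdAddChar_mulShift (n : ℕ) [NeZero n] (φ : AddChar (ZMod n) ℂ) :
    ∃ b : ZMod n, φ = (ZMod.stdAddChar (N := n)).mulShift b := by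
  classical
  have hinj : Function.Injective (ZMod.stdAddChar (N := n)).mulShift :=
    AddChar.to_mulShift_inj_of_isPrimitive (ZMod.isPrimitive_stdAddChar n)
  have hbij : Function.Bijective (ZMod.stdAddChar (N := n)).mulShift := by
    rw [Fintype.bijective_iff_injective_and_card]
    exact ⟨hinj, AddChar.card_eq.symm⟩
  obtain ⟨b, hb⟩ := hbij.2 φ
  exact ⟨b, hb.symm⟩

/-- `p ∤ Δ` unpacked: all `A_h ≢ 0` and `A_i B_j ≢ A_j B_i (mod p)` for `i ≠ j` in `H`. [folklore] -/
theorem ne_zero_of_not_dvd_polyDisc {H : Finset ℕ} {A B : ℕ → ℤ}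
    (hΔ : ¬ (p : ℤ) ∣ polyDisc H A B) :
    (∀ h ∈ H, (A h : ZMod p) ≠ 0) ∧
      ∀ i ∈ H, ∀ j ∈ H, i ≠ j → (A i : ZMod p) * (B j : ZMod p) - (A j : ZMod p) * (B i : ZMod p) ≠ 0 := by
  have hprime : Prime (p : ℤ) := Nat.prime_iff_prime_int.mp (Fact.out : p.Prime)
  unfold polyDisc at hΔ
  constructor
  · intro h hh hzero
    apply hΔ
    apply dvd_mul_of_dvd_left
    have : (p : ℤ) ∣ A h := by
      rw [← ZMod.intCast_zmod_eq_zero_iff_dvd]; exact hzero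
    exact this.trans (Finset.dvd_prod_of_mem _ hh)
  · intro i hi j hj hij hzero
    apply hΔ
    apply dvd_mul_of_dvd_right
    have : (p : ℤ) ∣ A i * B j - A j * B i := by
      rw [← ZMod.intCast_zmod_eq_zero_iff_dvd]; push_cast; exact hzero
    exact this.trans ((Finset.dvd_prod_of_mem (fun j => A i * B j - A j * B i)
      (Finset.mem_erase.mpr ⟨hij.symm, hj⟩)).trans
      (Finset.dvd_prod_of_mem (fun i => ∏ j ∈ H.erase i, (A i * B j - A j * B i)) hi))

/-- **Weil's bound at a good prime** ((3.13) for products of linear factors): for an odd prime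
`p ∤ Δ`, the quadratic character `ψ` mod `p`, `H ≠ ∅` and any additive character `φ`,
`‖Σ_{z mod p} Π_{h∈H} ψ(A_h z + B_h) φ(z)‖ ≤ #H √p` (the polynomial is `(Π A_h) Π_h (z + B_h/A_h)`
with distinct roots; `HybridLFunction.norm_hybridSum_add_le`). [cite: TaoTeravainen2021, §3.4 (3.13)] -/
theorem norm_polyCharSum_prime_le (hp2 : p ≠ 2) {ψ : DirichletCharacter ℂ p}
    (hψ : ψ = HybridLFunction.quadChar (ZMod p)) {H : Finset ℕ} (hH : H.Nonempty) {A B : ℕ → ℤ}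
    (hΔ : ¬ (p : ℤ) ∣ polyDisc H A B) (φ : AddChar (ZMod p) ℂ) :
    ‖polyCharSum p ψ H A B φ‖ ≤ #H * Real.sqrt p := by
  classical
  obtain ⟨hA, hAB⟩ := ne_zero_of_not_dvd_polyDisc (p := p) hΔ
  obtain ⟨b, rfl⟩ := exists_eq_stdAddChar_mulShift p φ
  have hF : ringChar (ZMod p) ≠ 2 := by rw [ZMod.ringChar_zmod_n]; exact hp2
  -- the roots `s_h = B_h / A_h` and the leading coefficient `c = Π A_h`
  set s : ℕ → ZMod p := fun h => (B h : ZMod p) * (A h : ZMod p)⁻¹ with hs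
  set c : ZMod p := ∏ h ∈ H, (A h : ZMod p) with hc
  have hc0 : c ≠ 0 := Finset.prod_ne_zero_iff.mpr fun h hh => hA h hh
  have hfac : ∀ z : ZMod p, ∏ h ∈ H, ψ ((A h : ZMod p) * z + (B h : ZMod p)) =
      ψ (c * ∏ h ∈ H, (z + s h)) := by
    intro z
    rw [hc, ← Finset.prod_mul_distrib, map_prod]
    refine Finset.prod_congr rfl fun h hh => ?_
    congr 1
    rw [hs]
    field_simp [hA h hh]
  -- transport the index set `H` to `Fin #H`
  set eH := H.equivFin with heH
  set s' : Fin #H → ZMod p := fun i => s (eH.symm i) with hs'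
  have hs'inj : Function.Injective s' := by
    intro i j hij
    by_contra hne
    have hne' : ((eH.symm i : H) : ℕ) ≠ (eH.symm j : H) := by
      intro h'
      exact hne (eH.symm.injective (Subtype.ext h'))
    have h1 := hAB _ (eH.symm i).2 _ (eH.symm j).2 hne'
    apply h1
    simp only [hs', hs] at hij
    have hAi := hA _ (eH.symm i).2
    have hAj := hA _ (eH.symm j).2
    field_simp at hij
    linear_combination -hij
  have hprod : ∀ z : ZMod p, ∏ h ∈ H, (z + s h) = ∏ i : Fin #H, (z + s' i) := by
    intro z
    rw [← Finset.prod_coe_sort H, Fintype.prod_equiv eH (fun x : H => z + s x) (fun i => z + s' i)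
      (fun x => by simp [hs'])]
  have hsum : polyCharSum p ψ H A B ((ZMod.stdAddChar (N := p)).mulShift b) =
      ∑ z : ZMod p, HybridLFunction.quadChar (ZMod p) (c * ∏ i : Fin #H, (z + s' i)) *
        ZMod.stdAddChar (b * z) := by
    unfold polyCharSum
    refine Finset.sum_congr rfl fun z _ => ?_
    rw [hfac, hprod, hψ, AddChar.mulShift_apply]
  rw [hsum]
  have h := HybridLFunction.norm_hybridSum_add_le (ZMod p) hF (ZMod.isPrimitive_stdAddChar p) hc0
    hs'inj (Finset.card_pos.mpr hH) b
  rwa [ZMod.card] at h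

end Prime

/-! ### The bound function and its arithmetic -/

/-- The local factor of the bound: `2^{3/2} √(2^e)` at `p = 2`, `#H √(p^e) √((p, |Δ|))` at odd `p`.
[cite: TaoTeravainen2021, §3.4] -/
def localBound (H : Finset ℕ) (Δ : ℤ) (p e : ℕ) : ℝ :=
  if p = 2 then (2 : ℝ) ^ ((3 : ℝ) / 2) * Real.sqrt ((2 : ℝ) ^ e)
  else (#H : ℝ) * Real.sqrt ((p : ℝ) ^ e) * Real.sqrt (Nat.gcd p Δ.natAbs)

/-- The global bound `Π_{p^e ∥ n} localBound p e`. [cite: TaoTeravainen2021, §3.4] -/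
def globalBound (H : Finset ℕ) (Δ : ℤ) (n : ℕ) : ℝ :=
  ∏ p ∈ n.primeFactors, localBound H Δ p (n.factorization p)

/-- The local factor is non-negative. [folklore] -/
theorem localBound_nonneg (H : Finset ℕ) (Δ : ℤ) (p e : ℕ) : 0 ≤ localBound H Δ p e := by
  unfold localBound; split_ifs <;> positivity

/-- The global bound is non-negative. [folklore] -/
theorem globalBound_nonneg (H : Finset ℕ) (Δ : ℤ) (n : ℕ) : 0 ≤ globalBound H Δ n :=
  Finset.prod_nonneg fun p _ => localBound_nonneg H Δ p _

/-- Multiplicativity of the global bound over coprime factors. [folklore] -/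
theorem globalBound_mul {a b : ℕ} (ha : a ≠ 0) (hb : b ≠ 0) (hab : a.Coprime b) (H : Finset ℕ)
    (Δ : ℤ) : globalBound H Δ (a * b) = globalBound H Δ a * globalBound H Δ b := by
  unfold globalBound
  rw [hab.primeFactors_mul, Finset.prod_union hab.disjoint_primeFactors]
  congr 1
  · refine Finset.prod_congr rfl fun p hp => ?_
    have hpb : ¬ p ∣ b := fun hdvd => by
      have hpa : p ∣ a := Nat.dvd_of_mem_primeFactors hp
      have h1 : p ∣ 1 := by rw [← hab.gcd_eq_one]; exact Nat.dvd_gcd hpa hdvd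
      exact (Nat.prime_of_mem_primeFactors hp).ne_one (Nat.dvd_one.mp h1)
    rw [Nat.factorization_mul ha hb, Finsupp.add_apply, Nat.factorization_eq_zero_of_not_dvd hpb,
      add_zero]
  · refine Finset.prod_congr rfl fun p hp => ?_
    have hpa : ¬ p ∣ a := fun hdvd => by
      have hpb : p ∣ b := Nat.dvd_of_mem_primeFactors hp
      have h1 : p ∣ 1 := by rw [← hab.gcd_eq_one]; exact Nat.dvd_gcd hdvd hpb
      exact (Nat.prime_of_mem_primeFactors hp).ne_one (Nat.dvd_one.mp h1)
    rw [Nat.factorization_mul ha hb, Finsupp.add_apply, Nat.factorization_eq_zero_of_not_dvd hpa,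
      zero_add]

/-- The global bound at a prime power. [folklore] -/
theorem globalBound_prime_pow {p e : ℕ} (hp : p.Prime) (he : 0 < e) (H : Finset ℕ) (Δ : ℤ) :
    globalBound H Δ (p ^ e) = localBound H Δ p e := by
  unfold globalBound
  rw [Nat.primeFactors_prime_pow he.ne' hp, Finset.prod_singleton, Nat.factorization_pow,
    Finsupp.smul_apply, hp.factorization_self, smul_eq_mul, mul_one]

/-- `globalBound 1 = 1`. [folklore] -/
theorem globalBound_one (H : Finset ℕ) (Δ : ℤ) : globalBound H Δ 1 = 1 := by
  unfold globalBound; simp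

/-! ### The global bound by induction over the factorisation of the modulus -/

/-- **CRT assembly** ("from the Chinese remainder theorem we obtain the bounds … `≪ τ(q)^{O(1)}
q^{1/2} d^{1/2}`"): for every modulus `n ≥ 1` carrying a PRIMITIVE QUADRATIC character `ψ`, every
non-empty `H` and every additive character `φ`, `‖polyCharSum n ψ H A B φ‖ ≤ globalBound n`
(prime powers: `2^e` with `e ≤ 3` by the trivial bound, odd `p` (necessarily `e = 1`) by Weil or
the trivial bound; coprime products by `polyCharSum_mul_of_coprime`). [cite: TaoTeravainen2021, §3.4] -/
theorem norm_polyCharSum_le_globalBound {H : Finset ℕ} (hH : H.Nonempty) (A B : ℕ → ℤ) :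
    ∀ (n : ℕ) [NeZero n] (ψ : DirichletCharacter ℂ n), ψ.IsPrimitive → ψ.IsQuadratic →
      ∀ φ : AddChar (ZMod n) ℂ, ‖polyCharSum n ψ H A B φ‖ ≤ globalBound H (polyDisc H A B) n := by
  intro n
  induction n using Nat.recOnPosPrimePosCoprime with
  | zero => intro inst; exact (NeZero.ne 0 rfl).elim
  | one =>
    intro _ ψ _ _ φ
    rw [globalBound_one]
    have h := norm_polyCharSum_le_card ψ H A B φ
    rwa [Nat.cast_one] at h
  | prime_pow p e hp he =>
    intro hne ψ hprim hquad φ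
    have hp' : p.Prime := hp
    rw [globalBound_prime_pow hp' he]
    unfold localBound
    by_cases hp2 : p = 2
    · subst hp2
      rw [if_pos rfl]
      have he3 : e = 2 ∨ e = 3 := eq_two_or_three_of_isPrimitive_two_pow he ψ hprim hquad
      have htriv := norm_polyCharSum_le_card ψ H A B φ
      refine htriv.trans ?_
      push_cast
      rcases he3 with rfl | rfl
      · -- `4 ≤ 2^{3/2} · 2`
        have h4 : Real.sqrt ((2 : ℝ) ^ 2) = 2 := Real.sqrt_sq (by norm_num)
        rw [h4]
        have : (2 : ℝ) ≤ (2 : ℝ) ^ ((3 : ℝ) / 2) := by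
          calc (2 : ℝ) = (2 : ℝ) ^ (1 : ℝ) := (Real.rpow_one 2).symm
            _ ≤ (2 : ℝ) ^ ((3 : ℝ) / 2) := Real.rpow_le_rpow_of_exponent_le (by norm_num) (by norm_num)
        nlinarith
      · -- `8 = 2^{3/2} · √8`
        have h8 : (2 : ℝ) ^ ((3 : ℝ) / 2) * Real.sqrt ((2 : ℝ) ^ 3) = 8 := by
          rw [Real.sqrt_eq_rpow, ← Real.rpow_natCast, ← Real.rpow_mul (by norm_num),
            ← Real.rpow_add (by norm_num)]
          norm_num
        rw [h8]; norm_num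
    · rw [if_neg hp2]
      have he1 : e = 1 := eq_one_of_isPrimitive_pow_odd hp' hp2 he ψ hprim hquad
      subst he1
      simp only [pow_one]
      -- now the modulus is the odd prime `p ^ 1`; transport to `p`
      haveI : Fact p.Prime := ⟨hp'⟩
      have key : ∀ (ψ' : DirichletCharacter ℂ p), ψ'.IsPrimitive → ψ'.IsQuadratic →
          ∀ φ' : AddChar (ZMod p) ℂ, ‖polyCharSum p ψ' H A B φ'‖ ≤
            (#H : ℝ) * Real.sqrt p * Real.sqrt (Nat.gcd p (polyDisc H A B).natAbs) := by
        intro ψ' hprim' hquad' φ'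
        by_cases hΔ : (p : ℤ) ∣ polyDisc H A B
        · -- degenerate prime: trivial bound `p ≤ #H √p √p`
          have hg : Nat.gcd p (polyDisc H A B).natAbs = p :=
            Nat.gcd_eq_left (Int.natCast_dvd.mp hΔ)
          rw [hg, mul_assoc, Real.mul_self_sqrt (Nat.cast_nonneg _)]
          refine (norm_polyCharSum_le_card ψ' H A B φ').trans ?_
          have h1 : (1 : ℝ) ≤ #H := by exact_mod_cast Finset.card_pos.mpr hH
          nlinarith [(Nat.cast_nonneg p : (0 : ℝ) ≤ p)]
        · -- good prime: Weil
          have hg : Nat.gcd p (polyDisc H A B).natAbs = 1 := by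
            rw [← Nat.coprime_iff_gcd_eq_one, Nat.Prime.coprime_iff_not_dvd hp']
            intro hdvd
            exact hΔ (Int.natCast_dvd.mpr hdvd)
          rw [hg, Nat.cast_one, Real.sqrt_one, mul_one]
          have hne : ψ' ≠ 1 := ne_one_of_isPrimitive hp'.one_lt hprim'
          have hψq := PrimitiveQuadratic.eq_quadraticChar_of_isQuadratic hp2 hquad' hne
          exact norm_polyCharSum_prime_le hp2 hψq hH hΔ φ'
      -- `p ^ 1 = p`: rewrite the goal along `pow_one` (reverting the instance too)
      revert φ hquad hprim ψ hne
      rw [pow_one]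
      intro hne ψ hprim hquad φ
      exact key ψ hprim hquad φ
  | coprime a b ha hb hab iha ihb =>
    intro _ ψ hprim hquad φ
    haveI : NeZero a := ⟨by omega⟩
    haveI : NeZero b := ⟨by omega⟩
    rw [polyCharSum_mul_of_coprime hab, norm_mul,
      globalBound_mul (by omega) (by omega) hab]
    exact mul_le_mul (iha (crtFst hab ψ) (isPrimitive_crtFst hab hprim) (IsQuadratic.crtFst hab hquad) _)
      (ihb (crtSnd hab ψ) (isPrimitive_crtSnd hab hprim) (IsQuadratic.crtSnd hab hquad) _) (norm_nonneg _)
      (globalBound_nonneg _ _ _)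

/-! ### The global bound in closed form -/

/-- `Π_{i ∈ s} √(f i) = √(Π_{i ∈ s} f i)` for natural numbers `f i`. [folklore] -/
theorem prod_sqrt_natCast (s : Finset ℕ) (f : ℕ → ℕ) :
    ∏ i ∈ s, Real.sqrt (f i) = Real.sqrt ((∏ i ∈ s, f i : ℕ) : ℝ) := by
  classical
  induction s using Finset.induction_on with
  | empty => simp
  | insert a s ha ih =>
    rw [Finset.prod_insert ha, Finset.prod_insert ha, ih, Nat.cast_mul,
      Real.sqrt_mul (Nat.cast_nonneg _)]

/-- The odd part of the bound: `Π_{p ∣ n, p ≠ 2} (p, |Δ|)` divides `(n, |Δ|)` (distinct primes).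
[folklore] -/
theorem prod_gcd_dvd_gcd (n : ℕ) (D : ℕ) :
    ∏ p ∈ n.primeFactors.filter (· ≠ 2), Nat.gcd p D ∣ Nat.gcd n D := by
  have h : ((∏ p ∈ n.primeFactors.filter (· ≠ 2), Nat.gcd p D : ℕ) : ℤ) ∣ (Nat.gcd n D : ℤ) := by
    rw [Nat.cast_prod]
    refine Finset.prod_dvd_of_coprime ?_ ?_
    · intro p hp p' hp' hne
      simp only [Finset.coe_filter, Set.mem_setOf_eq] at hp hp'
      have hpp : Nat.Coprime p p' :=
        (Nat.coprime_primes (Nat.prime_of_mem_primeFactors hp.1)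
          (Nat.prime_of_mem_primeFactors hp'.1)).mpr hne
      exact Nat.isCoprime_iff_coprime.mpr
        (Nat.Coprime.of_dvd (Nat.gcd_dvd_left _ _) (Nat.gcd_dvd_left _ _) hpp)
    · intro p hp
      rw [Finset.mem_filter] at hp
      exact Int.natCast_dvd_natCast.mpr
        (Nat.gcd_dvd_gcd_of_dvd_left _ (Nat.dvd_of_mem_primeFactors hp.1))
  exact Int.natCast_dvd_natCast.mp h

/-- `(p, |Δ|) ∣ (p, R)` for a prime `p` whenever `p ∣ Δ ⇒ p ∣ R`. [folklore] -/
theorem gcd_natAbs_dvd_gcd {p : ℕ} (hp : p.Prime) {Δ : ℤ} {R : ℕ} (hR : (p : ℤ) ∣ Δ → p ∣ R) :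
    Nat.gcd p Δ.natAbs ∣ Nat.gcd p R := by
  by_cases hd : p ∣ Δ.natAbs
  · have hpR : p ∣ R := hR (Int.natCast_dvd.mpr hd)
    rw [Nat.gcd_eq_left hd, Nat.gcd_eq_left hpR]
  · rw [(Nat.Prime.coprime_iff_not_dvd hp).mpr hd]
    exact one_dvd _

/-- `globalBound n ≤ 2^{3/2} · #H^{ω(n)} · √n · √((n, R))` for `n ≥ 1`, `H ≠ ∅`, and any `R`
divisible by every odd prime `p ∣ n` with `p ∣ Δ` (e.g. `R = |Δ|`). [cite: TaoTeravainen2021, §3.4] -/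
theorem globalBound_le {H : Finset ℕ} (hH : H.Nonempty) (Δ : ℤ) {n : ℕ} (hn : n ≠ 0) {R : ℕ}
    (hR : ∀ p ∈ n.primeFactors, p ≠ 2 → (p : ℤ) ∣ Δ → p ∣ R) :
    globalBound H Δ n ≤ (2 : ℝ) ^ ((3 : ℝ) / 2) * (#H : ℝ) ^ n.primeFactors.card * Real.sqrt n *
      Real.sqrt (Nat.gcd n R) := by
  classical
  have hH1 : (1 : ℝ) ≤ #H := by exact_mod_cast Finset.card_pos.mpr hH
  have h232 : (1 : ℝ) ≤ (2 : ℝ) ^ ((3 : ℝ) / 2) := Real.one_le_rpow (by norm_num) (by norm_num)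
  set P := n.primeFactors with hP
  -- split each local factor as `c p * r p * g p`
  set c : ℕ → ℝ := fun p => if p = 2 then (2 : ℝ) ^ ((3 : ℝ) / 2) else #H with hc
  set r : ℕ → ℝ := fun p => Real.sqrt ((p : ℝ) ^ n.factorization p) with hr
  set g : ℕ → ℝ := fun p => if p ≠ 2 then Real.sqrt (Nat.gcd p Δ.natAbs) else 1 with hg
  have hloc : ∀ p ∈ P, localBound H Δ p (n.factorization p) = c p * r p * g p := by
    intro p _
    unfold localBound
    simp only [hc, hr, hg]
    by_cases h2 : p = 2
    · subst h2; simp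
    · rw [if_neg h2, if_neg h2, if_pos h2]
  have hprod : globalBound H Δ n = (∏ p ∈ P, c p) * (∏ p ∈ P, r p) * ∏ p ∈ P, g p := by
    unfold globalBound
    rw [← hP, Finset.prod_congr rfl hloc, Finset.prod_mul_distrib, Finset.prod_mul_distrib]
  -- `∏ c ≤ 2^{3/2} #H^{ω(n)}`
  have hcb : ∏ p ∈ P, c p ≤ (2 : ℝ) ^ ((3 : ℝ) / 2) * (#H : ℝ) ^ P.card := by
    by_cases h2 : 2 ∈ P
    · rw [← Finset.mul_prod_erase P c h2]
      have hrest : ∏ p ∈ P.erase 2, c p = (#H : ℝ) ^ (P.erase 2).card := by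
        rw [← Finset.prod_const]
        refine Finset.prod_congr rfl fun p hp => ?_
        simp only [hc, if_neg (Finset.ne_of_mem_erase hp)]
      rw [hrest, show c 2 = (2 : ℝ) ^ ((3 : ℝ) / 2) by simp [hc]]
      refine mul_le_mul_of_nonneg_left ?_ (by positivity)
      exact pow_le_pow_right₀ hH1 (Finset.card_erase_le)
    · have hall : ∏ p ∈ P, c p = (#H : ℝ) ^ P.card := by
        rw [← Finset.prod_const]
        refine Finset.prod_congr rfl fun p hp => ?_
        have : p ≠ 2 := fun h => h2 (h ▸ hp)
        simp only [hc, if_neg this]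
      rw [hall]
      exact le_mul_of_one_le_left (by positivity) h232
  -- `∏ r = √n`
  have hrb : ∏ p ∈ P, r p = Real.sqrt n := by
    have h1 : ∏ p ∈ P, r p = ∏ p ∈ P, Real.sqrt ((p ^ n.factorization p : ℕ) : ℝ) := by
      refine Finset.prod_congr rfl fun p _ => ?_
      simp only [hr]; push_cast; rfl
    rw [h1, prod_sqrt_natCast, hP, ← Nat.prod_primeFactors_pow_factorization hn]
  -- `∏ g ≤ √((n, R))`
  have hgb : ∏ p ∈ P, g p ≤ Real.sqrt (Nat.gcd n R) := by
    rw [hg, ← Finset.prod_filter, prod_sqrt_natCast]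
    refine Real.sqrt_le_sqrt ?_
    have hgpos : 0 < Nat.gcd n R := Nat.gcd_pos_of_pos_left _ (Nat.pos_of_ne_zero hn)
    have hdvd : ∏ p ∈ P.filter (· ≠ 2), Nat.gcd p Δ.natAbs ∣ Nat.gcd n R := by
      refine (Finset.prod_dvd_prod_of_dvd _ _ fun p hp => ?_).trans (prod_gcd_dvd_gcd n R)
      rw [Finset.mem_filter] at hp
      exact gcd_natAbs_dvd_gcd (Nat.prime_of_mem_primeFactors hp.1) (hR p hp.1 hp.2)
    exact_mod_cast Nat.le_of_dvd hgpos hdvd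
  rw [hprod, hrb]
  have hsn : 0 ≤ Real.sqrt n := Real.sqrt_nonneg _
  calc (∏ p ∈ P, c p) * Real.sqrt n * ∏ p ∈ P, g p
      ≤ ((2 : ℝ) ^ ((3 : ℝ) / 2) * (#H : ℝ) ^ P.card) * Real.sqrt n * Real.sqrt (Nat.gcd n R) := by
        refine mul_le_mul (mul_le_mul_of_nonneg_right hcb hsn) hgb
          (Finset.prod_nonneg fun p _ => by simp only [hg]; split_ifs <;> positivity) (by positivity)
    _ = _ := by ring

/-- **Tao–Teräväinen §3.4, the complete-sum bound — PROVED.** For a primitive quadratic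
Dirichlet character `ψ` mod `q`, a non-empty `H`, integers `A_h, B_h`, every additive character
`φ` of `ℤ/qℤ`, and any natural number `R` divisible by every odd prime `p ∣ q` with `p ∣ Δ`,
`Δ = Π_h A_h · Π_{i≠j} (A_i B_j − A_j B_i)`:
`‖Σ_{z mod q} (Π_{h ∈ H} ψ(A_h z + B_h)) φ(z)‖ ≤ 2^{3/2} · #H^{ω(q)} · √q · √((q, R))`
("`≪ τ(q_χ)^{O(1)} q_χ^{1/2} d^{1/2}` uniformly in `a`, where `d` is the largest factor of `q_χ` for
which `f` is a constant multiple of a perfect square modulo `d`"). [cite: TaoTeravainen2021, §3.4] -/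
theorem norm_polyCharSum_le {q : ℕ} [NeZero q] {ψ : DirichletCharacter ℂ q}
    (hprim : ψ.IsPrimitive) (hquad : ψ.IsQuadratic) {H : Finset ℕ} (hH : H.Nonempty)
    (A B : ℕ → ℤ) (φ : AddChar (ZMod q) ℂ) {R : ℕ}
    (hR : ∀ p ∈ q.primeFactors, p ≠ 2 → (p : ℤ) ∣ polyDisc H A B → p ∣ R) :
    ‖polyCharSum q ψ H A B φ‖ ≤ (2 : ℝ) ^ ((3 : ℝ) / 2) * (#H : ℝ) ^ q.primeFactors.card *
      Real.sqrt q * Real.sqrt (Nat.gcd q R) :=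
  (norm_polyCharSum_le_globalBound hH A B q ψ hprim hquad φ).trans
    (globalBound_le hH _ (NeZero.ne q) hR)

/-- The special case `R = |Δ|`. [cite: TaoTeravainen2021, §3.4] -/
theorem norm_polyCharSum_le_natAbs {q : ℕ} [NeZero q] {ψ : DirichletCharacter ℂ q}
    (hprim : ψ.IsPrimitive) (hquad : ψ.IsQuadratic) {H : Finset ℕ} (hH : H.Nonempty)
    (A B : ℕ → ℤ) (φ : AddChar (ZMod q) ℂ) :
    ‖polyCharSum q ψ H A B φ‖ ≤ (2 : ℝ) ^ ((3 : ℝ) / 2) * (#H : ℝ) ^ q.primeFactors.card *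
      Real.sqrt q * Real.sqrt (Nat.gcd q (polyDisc H A B).natAbs) :=
  norm_polyCharSum_le hprim hquad hH A B φ fun _ _ _ h => Int.natCast_dvd.mp h

end PolyCharSum

end Literature.NumberTheory.LFunctions
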